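import Summits.KontsevichZagierPeriods.KontsevichZagierPeriods.Theorems.LinRedNormalFormArrangementNormalFormStubRebaseSimpleZeroManyChainBlow
import Summits.KontsevichZagierPeriods.KontsevichZagierPeriods.Theorems.LinRedNormalFormArrangementNormalFormStubRebaseSimpleZeroProductBlow

/-!
# Stub `stub_rebaseSimpleZeroMany`, part `rebaseSimpleZeroMany_common` (crux `ArrangementNormalForm`,
line `janus-bands`) — brick `ChainRadialMap`

Tools for the RADIAL CHART of a mixed pinch configuration of a clean chain of `n + 1` fibres
(worker W4's second blow-up chart for any number of fibres): after the `Z`-chart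
`(Y; u) ↦ (y₀ + ε₁ ε Y; t₀ + uₗ Y)` (brick `ChainBlowMap`) the slope `u_k` of the distinguished
fibre `k` becomes the NEW BASE `b` (coordinate swap `RebaseChain.swapIdx k`, rule 2 as
`KZ.IntegralRep.reindex`) and the old base `Y` is replaced by `Z = b Y` (the fibre blow-up
`RebaseZero.fibBlow k 0 0 0`, rule 2 in PUSH-FORWARD form `RebaseChain.cov_push`). The final
linking pattern `RebaseChain.rlo k A / rhi k B` is the chain `A < x₀ < ⋯ < xₙ < B` with the base
`y` itself sitting at the position `k` (`RebaseChain.xv`) and the radial fibre `0 < Z < y` at the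
index `k`; all its affine bounds are constants or literally `y` (`rlo_inr`, `rhi_inr`), so the
output is literally in `GG 0 2 (n + 1)`. Membership: `RebaseChain.mem_rDom`.
Registered: `rebaseSimpleZeroMany_covPush`.

References: M. Kontsevich, D. Zagier, *Periods* (2001), §1.2, rule (2).
-/

noncomputable section

open Set MeasureTheory MvPolynomial
open Literature.NumberTheory.Transcendental Literature.ModelTheory.ExponentialFields

namespace Summit.KontsevichZagierPeriods.ArrangementNormalForm.JanusBands

namespace RebaseChain

open SeparatePos RebasePos RebaseZero

/-! ### Rule (2), push-forward form -/

/-- **Rule (2), push-forward form.** If `Φ` is `ℚ`-semialgebraic, injective and differentiable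
on the domain of `r` with `Φ '' r.domain = R'` (`R'` semialgebraic), and `f'` is a
`ℚ`-semialgebraic function on `R'` with `r.integrand = (f' ∘ Φ) · |det Φ'|` on the domain, then
`f'` is absolutely integrable on `R'` and `r' = [R', f']` satisfies `[r] − [r'] ∈ KZ.relations`.
[folklore] -/
theorem cov_push {N : ℕ} (r : KZ.IntegralRep N) (Φ : (Fin N → ℝ) → (Fin N → ℝ))
    (Φ' : (Fin N → ℝ) → (Fin N → ℝ) →L[ℝ] (Fin N → ℝ)) (hsa : IsSemialgebraicMapOn ℚ r.domain Φ)
    (hder : ∀ x ∈ r.domain, HasFDerivWithinAt Φ (Φ' x) r.domain x) (hinj : InjOn Φ r.domain)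
    {R' : Set (Fin N → ℝ)} (hR' : IsSemialgebraic ℚ R') (himg : Φ '' r.domain = R')
    (f' : (Fin N → ℝ) → ℝ) (hf'sa : IsSemialgebraicFunOn ℚ R' f')
    (hf : ∀ x ∈ r.domain, r.integrand x = f' (Φ x) * |(Φ' x).det|) :
    ∃ r' : KZ.IntegralRep N, r'.domain = R' ∧ r'.integrand = f' ∧ KZ.of r - KZ.of r' ∈ KZ.relations := by
  have hDm : MeasurableSet r.domain := KZ.IntegralRep.measurableSet_domain_holds r
  have hint : IntegrableOn f' R' := by
    rw [← himg, integrableOn_image_iff_integrableOn_abs_det_fderiv_smul volume hDm hder hinj]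
    refine r.integrableOn.congr_fun (fun x hx => ?_) hDm
    rw [hf x hx, smul_eq_mul, mul_comm]
  exact ⟨⟨R', f', hR', hf'sa, hint⟩, rfl, rfl, KZ.changeOfVariablesRel_subset_relations
    ⟨N, r, _, Φ, Φ', hsa, hder, hinj, himg.symm, fun x hx => hf x hx, rfl⟩⟩

variable {n : ℕ}

/-! ### Swapping the base with a fibre -/

/-- The coordinate swap of the base `y` with the fibre `k`. [folklore] -/
def swapIdx (k : Fin (n + 1)) : Equiv.Perm (Fin (0 + 1 + (n + 1))) := Equiv.swap (yIdx (n + 1)) (tIdx k)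

variable (k : Fin (n + 1))

/-- After the swap the base is the old fibre `k`. -/
theorem yv_swapIdx (v : Fin (0 + 1 + (n + 1)) → ℝ) : yv (fun i => v (swapIdx k i)) = tv v k := by
  simp only [yv, swapIdx, Equiv.swap_apply_left]; rfl

/-- After the swap the fibre `k` is the old base. -/
theorem tv_swapIdx_self (v : Fin (0 + 1 + (n + 1)) → ℝ) : tv (fun i => v (swapIdx k i)) k = yv v := by
  simp only [tv, swapIdx, Equiv.swap_apply_right]; rfl

/-- The swap fixes the other fibres. -/
theorem tv_swapIdx_of_ne (v : Fin (0 + 1 + (n + 1)) → ℝ) {l : Fin (n + 1)} (hl : l ≠ k) :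
    tv (fun i => v (swapIdx k i)) l = tv v l := by
  simp only [tv, swapIdx]
  rw [Equiv.swap_apply_of_ne_of_ne (yIdx_ne_tIdx l).symm (tIdx_injective.ne hl)]

/-! ### The radial linking pattern -/

/-- Replacing the fibre `k` by the base form `y` in a player. -/
def rsub (k : Fin (n + 1)) : Fin (n + 1) ⊕ Cf → Fin (n + 1) ⊕ Cf :=
  Sum.elim (fun l' => if l' = k then Sum.inr (RebaseZero.mk 1 0) else Sum.inl l') Sum.inr

/-- Lower bounds of the RADIAL PATTERN: the chain `A < x₀ < ⋯ < xₙ` with `x_k = y` (the base),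
and `0 < Z` for the radial fibre at the index `k`. -/
def rlo (k : Fin (n + 1)) (A : Cf) : Fin (n + 1) → Fin (n + 1) ⊕ Cf := fun l =>
  if l = k then Sum.inr (RebaseZero.mk 0 0) else rsub k (clo A l)

/-- Upper bounds of the radial pattern: the chain `⋯ < xₙ < B` with `x_k = y`, and `Z < y`. -/
def rhi (k : Fin (n + 1)) (Bd : Cf) : Fin (n + 1) → Fin (n + 1) ⊕ Cf := fun l =>
  if l = k then Sum.inr (RebaseZero.mk 1 0) else rsub k (chi Bd l)

/-- The chain values of the radial pattern: the fibres, with the base at the position `k`. -/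
def xv (k : Fin (n + 1)) (z : Fin (0 + 1 + (n + 1)) → ℝ) : Fin (n + 1) → ℝ := fun l =>
  if l = k then yv z else tv z l

/-- The lower bound of the radial fibre. -/
theorem rlo_self (A : Cf) : rlo k A k = Sum.inr (RebaseZero.mk 0 0) := if_pos rfl

/-- The upper bound of the radial fibre. -/
theorem rhi_self (Bd : Cf) : rhi k Bd k = Sum.inr (RebaseZero.mk 1 0) := if_pos rfl

/-- The lower bounds of the other fibres. -/
theorem rlo_of_ne (A : Cf) {l : Fin (n + 1)} (hl : l ≠ k) : rlo k A l = rsub k (clo A l) := if_neg hl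

/-- The upper bounds of the other fibres. -/
theorem rhi_of_ne (Bd : Cf) {l : Fin (n + 1)} (hl : l ≠ k) : rhi k Bd l = rsub k (chi Bd l) := if_neg hl

/-- The radial comparisons `0 < Z < y`. -/
theorem radial_iff (z : Fin (0 + 1 + (n + 1)) → ℝ) :
    (pv (Sum.inr (RebaseZero.mk 0 0) : Fin (n + 1) ⊕ Cf) z < tv z k ∧
      tv z k < pv (Sum.inr (RebaseZero.mk 1 0) : Fin (n + 1) ⊕ Cf) z) ↔ (0 < tv z k ∧ tv z k < yv z) := by
  rw [RebaseZero.pv_inr, RebaseZero.pv_inr, ev_mk, ev_mk]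
  push_cast
  rw [zero_mul, zero_add, one_mul, add_zero]

/-- The value of a substituted player. -/
theorem pv_rsub (u : Fin (n + 1) ⊕ Cf) (z : Fin (0 + 1 + (n + 1)) → ℝ) :
    pv (rsub k u) z = Sum.elim (xv k z) (fun c => ev c (yv z)) u := by
  rcases u with l' | c
  · simp only [rsub, Sum.elim_inl, xv]
    by_cases h : l' = k
    · rw [if_pos h, if_pos h, RebaseZero.pv_inr, ev_mk]; push_cast; ring
    · rw [if_neg h, if_neg h, RebaseZero.pv_inl]
  · simp only [rsub, Sum.elim_inr, RebaseZero.pv_inr]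

/-- An affine lower bound of the radial pattern is `A` or the constant `0` or `y`. -/
theorem rlo_inr {A c : Cf} {l : Fin (n + 1)} (h : rlo k A l = Sum.inr c) :
    c = A ∨ c = RebaseZero.mk 0 0 ∨ c = RebaseZero.mk 1 0 := by
  simp only [rlo] at h
  split_ifs at h with hl
  · cases h; exact Or.inr (Or.inl rfl)
  · rcases hc : clo A l with l' | d
    · rw [hc, rsub, Sum.elim_inl] at h
      split_ifs at h
      cases h; exact Or.inr (Or.inr rfl)
    · rw [hc, rsub, Sum.elim_inr] at h
      cases h; exact Or.inl (clo_eq_inr hc)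

/-- An affine upper bound of the radial pattern is `B` or `y`. -/
theorem rhi_inr {Bd c : Cf} {l : Fin (n + 1)} (h : rhi k Bd l = Sum.inr c) :
    c = Bd ∨ c = RebaseZero.mk 1 0 := by
  simp only [rhi] at h
  split_ifs at h with hl
  · cases h; exact Or.inr rfl
  · rcases hc : chi Bd l with l' | d
    · rw [hc, rsub, Sum.elim_inl] at h
      split_ifs at h
      cases h; exact Or.inr rfl
    · rw [hc, rsub, Sum.elim_inr] at h
      cases h; exact Or.inl (chi_eq_inr hc)

/-- **The chain comparisons in order form** (any values `x`, affine ends read at `y`): the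
players `clo A`, `chi B` compare `x` to `A(y) < x₀ < x₁ < ⋯ < xₙ < B(y)`. [folklore] -/
theorem chain_iff (A Bd : Cf) (x : Fin (n + 1) → ℝ) (y : ℝ) :
    (∀ l, Sum.elim x (fun c => ev c y) (clo A l) < x l ∧ x l < Sum.elim x (fun c => ev c y) (chi Bd l)) ↔
      ev A y < x 0 ∧ StrictMono x ∧ x (Fin.last n) < ev Bd y := by
  rw [Fin.strictMono_iff_lt_succ, forall_and, Fin.forall_fin_succ, Fin.forall_fin_succ']
  simp only [clo_zero, clo_succ, chi_last, chi_castSucc, Sum.elim_inr, Sum.elim_inl]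
  constructor
  · rintro ⟨⟨h0, hl⟩, -, hn⟩
    exact ⟨h0, hl, hn⟩
  · rintro ⟨h0, hl, hn⟩
    exact ⟨⟨h0, hl⟩, hl, hn⟩

/-- **Membership in the radial pattern**: `0 < Z < y` for the radial fibre `k` and the chain
comparisons for the other fibres, read on the values `xv k z` (base at the position `k`). -/
theorem mem_rDom {m' : ℕ} (M : Fin m' → Cf) (A Bd : Cf) (z : Fin (0 + 1 + (n + 1)) → ℝ) :
    z ∈ gDom 0 (n + 1) m' M (rlo k A) (rhi k Bd) ↔ yv z ∈ cell M ∧ (0 < tv z k ∧ tv z k < yv z) ∧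
      ∀ l, l ≠ k → Sum.elim (xv k z) (fun c => ev c (yv z)) (clo A l) < xv k z l ∧
        xv k z l < Sum.elim (xv k z) (fun c => ev c (yv z)) (chi Bd l) := by
  rw [mem_gDom_iff]
  refine and_congr_right fun _ => ⟨fun h => ⟨?_, fun l hl => ?_⟩, fun h l => ?_⟩
  · have := h k
    rwa [rlo_self, rhi_self, radial_iff] at this
  · have := h l
    rw [rlo_of_ne k A hl, rhi_of_ne k Bd hl, pv_rsub, pv_rsub] at this
    simpa only [xv, if_neg hl] using this
  · by_cases hl : l = k
    · subst hl
      rw [rlo_self, rhi_self, radial_iff]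
      exact h.1
    · rw [rlo_of_ne k A hl, rhi_of_ne k Bd hl, pv_rsub, pv_rsub]
      simpa only [xv, if_neg hl] using h.2 l hl

/-- **The radial pattern with the end rows is the full chain.** If the rows contain
`A < y` and `y < B` (constants `A`, `B`), the chain comparisons at the position `k` itself follow,
so membership is `0 < Z < y` plus the full chain `A < x₀ < ⋯ < xₙ < B` on `xv k z`. -/
theorem mem_rDom_iff {m' : ℕ} (M : Fin m' → Cf) (A Bd : Cf) (hA : A.1 (Fin.last 0) = 0)
    (hB : Bd.1 (Fin.last 0) = 0) (hMA : ∀ y ∈ cell M, ev A y < y) (hMB : ∀ y ∈ cell M, y < ev Bd y)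
    (z : Fin (0 + 1 + (n + 1)) → ℝ) :
    z ∈ gDom 0 (n + 1) m' M (rlo k A) (rhi k Bd) ↔ yv z ∈ cell M ∧ (0 < tv z k ∧ tv z k < yv z) ∧
      (ev A (yv z) < xv k z 0 ∧ StrictMono (xv k z) ∧ xv k z (Fin.last n) < ev Bd (yv z)) := by
  have _hA := hA
  have _hB := hB
  rw [mem_rDom, ← chain_iff]
  refine and_congr_right fun hy => and_congr_right fun _ => ⟨fun h l => ?_, fun h l _ => h l⟩
  by_cases hl : l = k
  swap
  · exact h l hl
  subst hl
  have hxk : xv l z l = yv z := if_pos rfl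
  constructor
  · -- lower comparison at the position `k`
    induction l using Fin.cases with
    | zero => rw [clo_zero, Sum.elim_inr, hxk]; exact hMA _ hy
    | succ j =>
      rw [clo_succ, Sum.elim_inl, hxk]
      have hne : (j.castSucc : Fin (n + 1)) ≠ j.succ := ne_of_lt Fin.castSucc_lt_succ
      have := (h j.castSucc hne).2
      rwa [chi_castSucc, Sum.elim_inl, show xv j.succ z j.succ = yv z from if_pos rfl] at this
  · -- upper comparison at the position `k`
    induction l using Fin.lastCases with
    | last => rw [chi_last, Sum.elim_inr, hxk]; exact hMB _ hy
    | cast j =>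
      rw [chi_castSucc, Sum.elim_inl, hxk]
      have hne : (j.succ : Fin (n + 1)) ≠ j.castSucc := (ne_of_lt Fin.castSucc_lt_succ).symm
      have := (h j.succ hne).1
      rwa [clo_succ, Sum.elim_inl, show xv j.castSucc z j.castSucc = yv z from if_pos rfl] at this

end RebaseChain

/-- Registered support goal of this file (part of `rebaseSimpleZeroMany_common`): rule (2) in
push-forward form (`RebaseChain.cov_push`). -/
theorem rebaseSimpleZeroMany_covPush (N : ℕ) (r : KZ.IntegralRep N) (Φ : (Fin N → ℝ) → (Fin N → ℝ)) (Φ' : (Fin N → ℝ) → (Fin N → ℝ) →L[ℝ] (Fin N → ℝ)) (hsa : IsSemialgebraicMapOn ℚ r.domain Φ) (hder : ∀ x ∈ r.domain, HasFDerivWithinAt Φ (Φ' x) r.domain x) (hinj : InjOn Φ r.domain) (R' : Set (Fin N → ℝ)) (hR' : IsSemialgebraic ℚ R') (himg : Φ '' r.domain = R') (f' : (Fin N → ℝ) → ℝ) (hf'sa : IsSemialgebraicFunOn ℚ R' f') (hf : ∀ x ∈ r.domain, r.integrand x = f' (Φ x) * |(Φ' x).det|) : ∃ r' : KZ.IntegralRep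 N, r'.domain = R' ∧ r'.integrand = f' ∧ KZ.of r - KZ.of r' ∈ KZ.relations :=
  RebaseChain.cov_push r Φ Φ' hsa hder hinj hR' himg f' hf'sa hf

end Summit.KontsevichZagierPeriods.ArrangementNormalForm.JanusBands
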